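import Summits.SmoothPoincare4.SmoothPoincare4.Theorems.ConvexBisectionAcyclicBisectionExistsEOneCurveGeometry
import HarnessLib

/-!
# The round four-point loop of the `e_1`-curve: separation from the chords of the model chain
(wave 7, brick H5-1b of the last geometric input (R-E1CURVE) of node N3a `node_STcurve` of stub
`stub_STgeo` = NF4 N3, line `modp-braid-orbits`, crux `ConvexBisection.AcyclicBisectionExists`,
item stmt-SmoothPoincare4-10508; registered sub-goal `helper_eOne_separation`)

Sequel of `…EOneCurveGeometry.lean` (centre `c₀ = (2/5) ϖ`, radius `R`, `ϖ = e^{4iθ_0}`,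
`θ_0 = π/(2g+1)`, `c = cos θ_0`, `σ = sin θ_0`).

* §3 **separation** (`helper_eOne_separation`): every point of the circle `‖x − c₀‖ = R` is at
  distance `> δ = σ²/8` from every chord `[ζ_m, ζ_{m+1}]` with `m ≤ 2` or `4 ≤ m ≤ 2g − 1` — the
  chords of Y4's model chain other than `[ζ_3, ζ_4]`.  In the rotated coordinate `x' = x ϖ⁻¹`: near
  the closed unit disc the circle `‖x' − 2/5‖ = R` runs in the half-plane `Re x' < cos 3θ_0 − δ`
  while the inside chords lie in `Re ≥ cos 3θ_0` (`sep_core_inside`); away from the deep interior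
  `‖x'‖ < c − δ` it runs in `Re x' > cos 5θ_0 + δ` while the outside chords lie in `Re ≤ cos 5θ_0`,
  `‖·‖ ≥ c` (`sep_core_outside`, `g ≥ 3`); both are polynomial inequalities in `c ≥ 0.8` / `0.89`.
* §4 the collar width of Y4's charts: `jX t` is within `σ(‖t‖ − 1)` of the symmetric chord
  `[η̄, η]` (`exists_chord_near_jX`, compare with `jX (t/‖t‖)`), and `σ/(4(2g+1)) ≤ δ`.

Everything is proved; no `sorry`.  References: J. Milnor, *Singular points of complex
hypersurfaces* (1968), §9 [Milnor1968]; B. Farb, D. Margalit, *A primer on mapping class groups*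
(2012), §6.1 [FarbMargalit2012].
-/

noncomputable section

set_option linter.dupNamespace false

open scoped Manifold ContDiff Topology ComplexConjugate Real
open Set Function Metric Complex
open Literature.Topology.FourManifolds Literature.Topology.FourManifolds.LefschetzBase
  Literature.Topology.FourManifolds.TorusKnotMilnor

namespace Summit.SmoothPoincare4.SmoothPoincare4.Theorems.AcyclicBisectionExists.ModpBraidOrbits

variable {g : ℕ}

/-! ## §3 Separation of the loop from the other chords -/

/-- `‖z − t‖² = ‖z‖² − 2t Re z + t²` for real `t`. [folklore] -/
theorem norm_sub_real_sq (z : ℂ) (t : ℝ) : ‖z - t‖ ^ 2 = ‖z‖ ^ 2 - 2 * t * z.re + t ^ 2 := by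
  rw [Complex.sq_norm, Complex.sq_norm, Complex.normSq_apply, Complex.normSq_apply]
  simp only [Complex.sub_re, Complex.sub_im, Complex.ofReal_re, Complex.ofReal_im, sub_zero]
  ring

/-- **Separation, inside chords** (`g ≥ 2`): a point `x'` of the circle `‖x' − 2/5‖ = R` is at
distance `> sin² θ_0 / 8` from every point `p'` of the closed unit disc with `Re p' ≥ cos 3θ_0`
(such `x'` near the disc have `Re x' < cos 3θ_0 − δ`). [folklore] -/
theorem sep_core_inside (hg : 2 ≤ g) {x' p' : ℂ} (hx : ‖x' - (2 / 5 : ℝ)‖ = eoRad g) (hp1 : ‖p'‖ ≤ 1)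
    (hp3 : Real.cos (3 * branchAngle g 0) ≤ p'.re) : shalf g ^ 2 / 8 < ‖x' - p'‖ := by
  by_contra hcon
  push Not at hcon
  set δ := shalf g ^ 2 / 8 with hδ
  have hc := cmid_ge hg
  have hc1 := cmid_lt_one (by omega : 1 ≤ g)
  have hcs := cmid_sq_add_shalf_sq g
  have hδ0 : 0 ≤ δ := by positivity
  -- `‖x'‖ ≤ 1 + δ` and `Re x' ≥ cos 3θ_0 − δ`
  have hn : ‖x'‖ ≤ 1 + δ := by
    have := norm_sub_le_norm_sub_add_norm_sub x' p' 0
    simp only [sub_zero] at this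
    have : ‖x'‖ ≤ ‖x' - p'‖ + ‖p'‖ := by
      calc ‖x'‖ = ‖(x' - p') + p'‖ := by ring_nf
        _ ≤ ‖x' - p'‖ + ‖p'‖ := norm_add_le _ _
    linarith
  have hre : Real.cos (3 * branchAngle g 0) - δ ≤ x'.re := by
    have h1 : |(x' - p').re| ≤ ‖x' - p'‖ := Complex.abs_re_le_norm _
    rw [Complex.sub_re] at h1
    have := (abs_le.1 h1).1
    linarith
  -- the circle: `(4/5) Re x' = ‖x'‖² − 1 + (4/5) cos 4θ_0`
  have hcirc := norm_sub_real_sq x' (2 / 5)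
  rw [hx, eoRad_sq, cos_four_a] at hcirc
  rw [cos_three_a] at hre
  have hn2 : ‖x'‖ ^ 2 ≤ (1 + δ) ^ 2 := pow_le_pow_left₀ (norm_nonneg _) hn 2
  -- polynomial margin: `cos 3θ_0 − cos 4θ_0 = (1 − c)(8c³ + 4c² − 4c − 1) ≥ 2 (1 − c)`
  have hq : 2 ≤ 8 * cmid g ^ 3 + 4 * cmid g ^ 2 - 4 * cmid g - 1 := by nlinarith
  have hs2 : shalf g ^ 2 = (1 - cmid g) * (1 + cmid g) := by nlinarith
  have hδ' : δ = (1 - cmid g) * (1 + cmid g) / 8 := by rw [hδ, hs2]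
  have hδ1 : δ ≤ 1 / 4 := by rw [hδ']; nlinarith
  nlinarith [mul_le_mul_of_nonneg_left hq (by linarith : (0:ℝ) ≤ 1 - cmid g),
    mul_nonneg hδ0 (by linarith : (0:ℝ) ≤ 1 - cmid g)]

/-- **Separation, outside chords** (`g ≥ 3`): a point `x'` of the circle `‖x' − 2/5‖ = R` is at
distance `> sin² θ_0 / 8` from every point `p'` with `cos θ_0 ≤ ‖p'‖` and `Re p' ≤ cos 5θ_0`
(such `x'` away from the deep interior have `Re x' > cos 5θ_0 + δ`). [folklore] -/
theorem sep_core_outside (hg : 3 ≤ g) {x' p' : ℂ} (hx : ‖x' - (2 / 5 : ℝ)‖ = eoRad g) (hpc : cmid g ≤ ‖p'‖)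
    (hp5 : p'.re ≤ Real.cos (5 * branchAngle g 0)) : shalf g ^ 2 / 8 < ‖x' - p'‖ := by
  by_contra hcon
  push Not at hcon
  set δ := shalf g ^ 2 / 8 with hδ
  have hc := cmid_ge' hg
  have hc1 := cmid_lt_one (by omega : 1 ≤ g)
  have hcs := cmid_sq_add_shalf_sq g
  have hδ0 : 0 ≤ δ := by positivity
  have hs2 : shalf g ^ 2 = (1 - cmid g) * (1 + cmid g) := by nlinarith
  have hδ' : δ = (1 - cmid g) * (1 + cmid g) / 8 := by rw [hδ, hs2]
  have hδ1 : δ ≤ 1 / 20 := by rw [hδ']; nlinarith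
  -- `‖x'‖ ≥ c − δ ≥ 0` and `Re x' ≤ cos 5θ_0 + δ`
  have hn : cmid g - δ ≤ ‖x'‖ := by
    have : ‖p'‖ ≤ ‖p' - x'‖ + ‖x'‖ := by
      calc ‖p'‖ = ‖(p' - x') + x'‖ := by ring_nf
        _ ≤ ‖p' - x'‖ + ‖x'‖ := norm_add_le _ _
    rw [norm_sub_rev] at this
    linarith
  have hre : x'.re ≤ Real.cos (5 * branchAngle g 0) + δ := by
    have h1 : |(x' - p').re| ≤ ‖x' - p'‖ := Complex.abs_re_le_norm _
    rw [Complex.sub_re] at h1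
    have := (abs_le.1 h1).2
    linarith
  have hcirc := norm_sub_real_sq x' (2 / 5)
  rw [hx, eoRad_sq, cos_four_a] at hcirc
  rw [cos_five_a] at hre
  have hn2 : (cmid g - δ) ^ 2 ≤ ‖x'‖ ^ 2 := pow_le_pow_left₀ (by linarith) hn 2
  -- polynomial margin: `cos 4θ_0 − cos 5θ_0 = (1 − c) P(c)`, `P(c) ≥ 3.61` for `c ≥ 0.89`
  have hq : 3.61 ≤ 16 * cmid g ^ 4 + 8 * cmid g ^ 3 - 12 * cmid g ^ 2 - 4 * cmid g + 1 := by
    have e : 16 * cmid g ^ 4 + 8 * cmid g ^ 3 - 12 * cmid g ^ 2 - 4 * cmid g + 1 =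
        (cmid g - 0.89) * (16 * cmid g ^ 3 + 22.24 * cmid g ^ 2 + 7.7936 * cmid g + 2.936304) + 3.61331056 := by
      ring
    have hq' : 0 ≤ 16 * cmid g ^ 3 + 22.24 * cmid g ^ 2 + 7.7936 * cmid g + 2.936304 := by positivity
    nlinarith [mul_nonneg (by linarith : (0:ℝ) ≤ cmid g - 0.89) hq']
  nlinarith [mul_le_mul_of_nonneg_left hq (by linarith : (0:ℝ) ≤ 1 - cmid g),
    mul_nonneg hδ0 (by linarith : (0:ℝ) ≤ 1 - cmid g)]

/-- The reduced rotation `E = e^{−4iθ_0}`: `‖E‖ = 1` and `ϖ E = 1`. [folklore] -/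
theorem rootU_sq_mul_expNeg (g : ℕ) :
    rootU (2 * g + 1) ^ 2 * cexp (((-(4 * branchAngle g 0) : ℝ) : ℂ) * I) = 1 := by
  rw [rootU_sq_eq_exp, ← Complex.exp_add]
  push_cast
  ring_nf
  exact Complex.exp_zero

/-- A rotated chord point: `chordX g m s · E = (1 − s) e^{i(θ_m − 4θ_0)} + s e^{i(θ_{m+1} − 4θ_0)}`. [folklore] -/
theorem chordX_mul_expNeg (g m : ℕ) (s : ℝ) :
    chordX g m s * cexp (((-(4 * branchAngle g 0) : ℝ) : ℂ) * I) =
      (1 - s) * cexp (((branchAngle g m - 4 * branchAngle g 0 : ℝ) : ℂ) * I) +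
        s * cexp (((branchAngle g (m + 1) - 4 * branchAngle g 0 : ℝ) : ℂ) * I) := by
  have h := rootU_sq_mul_expNeg g
  have e : ∀ k : ℕ, branchPt g k * cexp (((-(4 * branchAngle g 0) : ℝ) : ℂ) * I) =
      cexp (((branchAngle g k - 4 * branchAngle g 0 : ℝ) : ℂ) * I) := fun k => by
    rw [branchPt_eq_rot_mul, mul_right_comm, h, one_mul]
  rw [chordX, add_mul, mul_assoc, mul_assoc, e m, e (m + 1)]

/-- A convex combination of two unit vectors at angular distance `2θ_0`: norm in `[cos θ_0, 1]`,
real part between the two cosines. [folklore] -/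
theorem convex_two_exp {θ₁ θ₂ : ℝ} (h : θ₂ = θ₁ + 2 * branchAngle g 0) {s : ℝ} (hs : s ∈ Icc (0 : ℝ) 1) :
    ‖((1 - s) * cexp ((θ₁ : ℂ) * I) + s * cexp ((θ₂ : ℂ) * I) : ℂ)‖ ≤ 1 ∧
    cmid g ≤ ‖((1 - s) * cexp ((θ₁ : ℂ) * I) + s * cexp ((θ₂ : ℂ) * I) : ℂ)‖ ∧
    (((1 - s) * cexp ((θ₁ : ℂ) * I) + s * cexp ((θ₂ : ℂ) * I) : ℂ)).re =
      (1 - s) * Real.cos θ₁ + s * Real.cos θ₂ := by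
  set p : ℂ := (1 - s) * cexp ((θ₁ : ℂ) * I) + s * cexp ((θ₂ : ℂ) * I) with hp
  have hre : p.re = (1 - s) * Real.cos θ₁ + s * Real.cos θ₂ := by
    rw [hp]; simp [Complex.exp_ofReal_mul_I_re, Complex.exp_ofReal_mul_I_im]
  have him : p.im = (1 - s) * Real.sin θ₁ + s * Real.sin θ₂ := by
    rw [hp]; simp [Complex.exp_ofReal_mul_I_re, Complex.exp_ofReal_mul_I_im]
  have hsq : ‖p‖ ^ 2 = (1 - s) ^ 2 + s ^ 2 + 2 * s * (1 - s) * Real.cos (2 * branchAngle g 0) := by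
    rw [Complex.sq_norm, Complex.normSq_apply, hre, him]
    have e2 : Real.cos (2 * branchAngle g 0) = Real.cos (θ₂ - θ₁) := by rw [h]; ring_nf
    rw [e2, Real.cos_sub]
    nlinarith [Real.cos_sq_add_sin_sq θ₁, Real.cos_sq_add_sin_sq θ₂]
  rw [Real.cos_two_mul] at hsq
  have hcs := cmid_sq_add_shalf_sq g
  unfold cmid shalf at hcs
  unfold cmid
  have hp0 : 0 ≤ ‖p‖ := norm_nonneg _
  have hcos1 : Real.cos (branchAngle g 0) ≤ 1 := Real.cos_le_one _
  refine ⟨?_, ?_, hre⟩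
  · refine le_of_pow_le_pow_left₀ two_ne_zero zero_le_one ?_
    rw [hsq, one_pow]
    nlinarith [mul_nonneg hs.1 (sub_nonneg.2 hs.2)]
  · rcases le_or_gt 0 (Real.cos (branchAngle g 0)) with hc0 | hc0
    · refine le_of_pow_le_pow_left₀ two_ne_zero hp0 ?_
      rw [hsq]
      have h4 : s * (1 - s) ≤ 1 / 4 := by nlinarith [sq_nonneg (s - 1 / 2)]
      nlinarith [mul_nonneg hs.1 (sub_nonneg.2 hs.2), sq_nonneg (Real.sin (branchAngle g 0))]
    · linarith

/-- **Sub-goal `helper_eOne_separation`** (H5-1, plane geometry of the round four-point loop of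
(R-E1CURVE), node N3a of NF4): every point of the circle `‖x − c₀‖ = R` (`c₀ = eoCenter g`,
`R = eoRad g`) is at distance `> sin²(π/(2g+1))/8` from every point of every chord `[ζ_m, ζ_{m+1}]`
with `m ≤ 2` or `4 ≤ m ≤ 2g − 1` — all chords of Y4's model chain except `[ζ_3, ζ_4]` (`g ≥ 2`).
[folklore] -/
theorem helper_eOne_separation : ∀ (g : ℕ) (_hg : 2 ≤ g) (m : ℕ), (m ≤ 2 ∨ (4 ≤ m ∧ m + 2 ≤ 2 * g + 1)) → ∀ (x : ℂ), ‖x - Summit.SmoothPoincare4.SmoothPoincare4.Theorems.AcyclicBisectionExists.ModpBraidOrbits.eoCenter g‖ = Summit.SmoothPoincare4.SmoothPoincare4.Theorems.AcyclicBisectionExists.ModpBraidOrbits.eoRad g → ∀ s ∈ Set.Icc (0 : ℝ) 1, Summit.SmoothPoincare4.SmoothPoincare4.Theorems.AcyclicBisectionExists.ModpBraidOrbits.shalf g ^ 2 / 8 < ‖x - Literature.Topology.FourManifolds.LefschetzBase.chordX g m s‖ := by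
  intro g hg m hm x hx s hs
  set E : ℂ := cexp (((-(4 * branchAngle g 0) : ℝ) : ℂ) * I) with hE
  have hEn : ‖E‖ = 1 := Complex.norm_exp_ofReal_mul_I _
  have hrot : ‖x - chordX g m s‖ = ‖x * E - chordX g m s * E‖ := by
    rw [← sub_mul, norm_mul, hEn, mul_one]
  have hx' : ‖x * E - (2 / 5 : ℝ)‖ = eoRad g := by
    have e : x * E - (2 / 5 : ℝ) = (x - eoCenter g) * E := by
      rw [sub_mul, eoCenter, mul_assoc, rootU_sq_mul_expNeg]; push_cast; ring
    rw [e, norm_mul, hEn, mul_one, hx]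
  rw [hrot, chordX_mul_expNeg]
  have hang : branchAngle g (m + 1) - 4 * branchAngle g 0 = (branchAngle g m - 4 * branchAngle g 0) + 2 * branchAngle g 0 := by
    rw [branchAngle_eq_mul g (m + 1), branchAngle_eq_mul g m]; push_cast; ring
  obtain ⟨hp1, hpc, hpre⟩ := convex_two_exp (g := g) hang hs
  push_cast at hp1 hpc hpre ⊢
  rcases hm with hm | ⟨hm4, hmn⟩
  · refine sep_core_inside hg hx' hp1 ?_
    rw [hpre]
    have h1 := cos_three_a_le_cos_red (g := g) (by omega) (show m < 4 by omega)
    have h2 := cos_three_a_le_cos_red (g := g) (by omega) (show m + 1 < 4 by omega)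
    nlinarith [hs.1, hs.2]
  · have hg3 : 3 ≤ g := by omega
    refine sep_core_outside hg3 hx' hpc ?_
    rw [hpre]
    have h1 := cos_red_le_cos_five_a hg hm4 (by omega)
    have h2 := cos_red_le_cos_five_a hg (show 4 ≤ m + 1 by omega) (by omega)
    nlinarith [hs.1, hs.2]

/-! ## §4 The collar width of the model charts -/

/-- The symmetric chord: `chordX g (2g) s = m + iσ(2s − 1)`. [folklore] -/
theorem chordX_two_mul (g : ℕ) (s : ℝ) :
    chordX g (2 * g) s = (cmid g : ℂ) + (shalf g : ℂ) * I * (2 * s - 1) := by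
  have h0 : branchPt g (2 * g + 1) = branchPt g 0 := by
    rw [branchPt, branchPt, branchAngle_eq_mul g (2 * g + 1)]
    have hπ : (((2 * (g : ℝ) + 1) * branchAngle g 0 : ℝ) : ℂ) = (π : ℂ) := by
      rw [mul_branchAngle_zero g]
    have e : (((2 * ((2 * g + 1 : ℕ) : ℝ) + 1) * branchAngle g 0 : ℝ) : ℂ) * I =
        ((branchAngle g 0 : ℝ) : ℂ) * I + 2 * π * I := by
      push_cast at hπ ⊢
      linear_combination (2 * I) * hπ
    rw [e, Complex.exp_add, Complex.exp_two_pi_mul_I, mul_one]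
  have h1 : branchPt g (2 * g) = conj (branchPt g 0) := by
    have := branchPt_two_mul_sub (g := g) (k := 0) (Nat.zero_le _); rwa [Nat.sub_zero] at this
  rw [chordX, h0, h1, branchPt_zero_eq, map_add, map_mul, Complex.conj_ofReal, Complex.conj_ofReal,
    Complex.conj_I]
  ring

/-- `jX` at a unit vector `τ₁` is the chord point `m + iσ Re τ₁`. [folklore] -/
theorem jX_of_norm_eq_one (g : ℕ) {τ₁ : ℂ} (h : ‖τ₁‖ = 1) :
    jX g τ₁ = (cmid g : ℂ) + (shalf g : ℂ) * I * (τ₁.re : ℂ) := by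
  have hinv : τ₁⁻¹ = conj τ₁ := by
    rw [Complex.inv_def, Complex.normSq_eq_norm_sq, h]; simp
  rw [jX, hinv, Complex.add_conj]; push_cast; ring

/-- **The collar width**: for `‖τ‖ ≥ 1` the point `jX τ` is within `σ (‖τ‖ − 1)` of the symmetric
chord `[η̄, η]` (compare with `jX (τ/‖τ‖)`). [folklore] -/
theorem exists_chord_near_jX (hg : 1 ≤ g) {τ : ℂ} (h1 : 1 ≤ ‖τ‖) :
    ∃ s ∈ Icc (0 : ℝ) 1, ‖jX g τ - chordX g (2 * g) s‖ ≤ shalf g * (‖τ‖ - 1) := by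
  have hρ : 0 < ‖τ‖ := by linarith
  have hτ : τ ≠ 0 := norm_pos_iff.1 hρ
  set τ₁ : ℂ := ((‖τ‖⁻¹ : ℝ) : ℂ) * τ with hτ₁
  have hτ₁n : ‖τ₁‖ = 1 := by
    rw [hτ₁, norm_mul, Complex.norm_real, Real.norm_eq_abs, abs_of_pos (inv_pos.2 hρ), inv_mul_cancel₀ hρ.ne']
  have hre1 : |τ₁.re| ≤ 1 := hτ₁n ▸ Complex.abs_re_le_norm τ₁
  refine ⟨(1 + τ₁.re) / 2, ⟨by linarith [(abs_le.1 hre1).1], by linarith [(abs_le.1 hre1).2]⟩, ?_⟩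
  have hch : chordX g (2 * g) ((1 + τ₁.re) / 2) = jX g τ₁ := by
    rw [chordX_two_mul, jX_of_norm_eq_one g hτ₁n]; push_cast; ring
  rw [hch, jX, jX]
  have e : (cmid g : ℂ) + (shalf g : ℂ) * I * ((τ + τ⁻¹) / 2) - ((cmid g : ℂ) + (shalf g : ℂ) * I * ((τ₁ + τ₁⁻¹) / 2))
      = (shalf g : ℂ) * I * (((τ - τ₁) + (τ⁻¹ - τ₁⁻¹)) / 2) := by ring
  rw [e, norm_mul, norm_mul, Complex.norm_I, mul_one, Complex.norm_real, Real.norm_eq_abs,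
    abs_of_pos (shalf_pos hg), norm_div, Complex.norm_two]
  refine mul_le_mul_of_nonneg_left ?_ (shalf_pos hg).le
  have hd1 : ‖τ - τ₁‖ = ‖τ‖ - 1 := by
    have e1 : τ - τ₁ = ((1 - ‖τ‖⁻¹ : ℝ) : ℂ) * τ := by rw [hτ₁]; push_cast; ring
    rw [e1, norm_mul, Complex.norm_real, Real.norm_eq_abs, abs_of_nonneg (by
      rw [sub_nonneg]; exact inv_le_one_of_one_le₀ h1)]
    field_simp
  have hd2 : ‖τ⁻¹ - τ₁⁻¹‖ ≤ ‖τ‖ - 1 := by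
    have e1 : τ₁⁻¹ = ((‖τ‖ : ℝ) : ℂ) * τ⁻¹ := by rw [hτ₁, mul_inv, ← Complex.ofReal_inv, inv_inv]
    have e2 : τ⁻¹ - τ₁⁻¹ = ((1 - ‖τ‖ : ℝ) : ℂ) * τ⁻¹ := by rw [e1]; push_cast; ring
    rw [e2, norm_mul, Complex.norm_real, Real.norm_eq_abs, abs_of_nonpos (by linarith), norm_inv]
    have : ‖τ‖⁻¹ ≤ 1 := inv_le_one_of_one_le₀ h1
    nlinarith
  calc ‖(τ - τ₁) + (τ⁻¹ - τ₁⁻¹)‖ / 2 ≤ (‖τ - τ₁‖ + ‖τ⁻¹ - τ₁⁻¹‖) / 2 := by gcongr; exact norm_add_le _ _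
    _ ≤ ‖τ‖ - 1 := by rw [hd1]; linarith

/-- `σ/(4(2g+1)) ≤ σ²/8` (`σ ≥ 2/(2g+1)`). [folklore] -/
theorem shalf_div_le (hg : 1 ≤ g) : shalf g * (1 / (4 * (2 * g + 1))) ≤ shalf g ^ 2 / 8 := by
  have h := two_div_le_shalf hg
  have h0 : (0 : ℝ) < 2 * g + 1 := by positivity
  have e : 1 / (4 * (2 * (g : ℝ) + 1)) = (2 / (2 * g + 1)) / 8 := by field_simp; ring
  rw [e]
  nlinarith [shalf_pos hg]

end Summit.SmoothPoincare4.SmoothPoincare4.Theorems.AcyclicBisectionExists.ModpBraidOrbits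

end
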